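import Literature.MathematicalPhysics.QuantumFieldTheory.Balaban1983to89.B3Ineq210ZeroLattice
import Literature.MathematicalPhysics.QuantumFieldTheory.Balaban1983to89.B3Ineq211ZeroBox

/-!
# `Balaban1983to89.B3Ineq211ZeroLattice` — T. Bałaban, *(Higgs)₂,₃ quantum fields in a finite volume. III. Renormalization*,
# Commun. Math. Phys. **88** (1983) 411–445 [Balaban1983Higgs3]: the Hölder bound (2.11) p. 426 FOR THE PRINT'S OWN §3
# PROPAGATOR `G_k(0) = G_k(ηℤ^{d+1}, 0)` (p. 433) — r15's decl of record `B3Sect2StatementsPart2.ScaledKernels.Ineq211At α δ₁ C`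
# DISCHARGED, for each `0 ≤ α < 1` (and uniformly on every `[0, α⋆]`, `α⋆ < 1`), for the concrete carrier `zeroLatticeKernelsH`
# of the lattice pieces `G^η_{(j)}(0)` of `B3Ineq210ZeroLattice`, together with (2.10) on the same carrier

statement-level skeleton of published theorems with citation tags; proofs where landed; nothing here is a claim about the Yang–Mills mass gap

PDF held: `paper:balaban1983-higgs-2-3-quantum-fields-finite-volume` (journal page = PDF page + 410); p. 426 [PDF 16] ((2.10)–(2.12)),
p. 433 [PDF 23] (*"with the scalar field propagator equal to G_k(0)"*), p. 434 [PDF 24] (*"We apply the decomposition (2.6) to the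
propagators G_k(0), G_k"*), p. 436 [PDF 26] ((3.13)–(3.14): where (2.11) is consumed) read in the OCR text (`p0016.txt`, `p0023.txt`,
`p0024.txt`, `p0026.txt`).

CITATION HEADER (lean-in-tree rule).  Part of the lit-balaban TYPED SKELETON (HOME `run/shared/lean/pub/lit-balaban/`), Phase 2:
SKELETON row **B3.Eq2.11** (decl of record `ScaledKernels.Ineq211At`, fold owner r15; head `proved` on the regular-background
torus/region members) — the LOCATED MEMBER «zero field, `Ω = ηℤ^{d+1}`» = the print's §3 carrier (owner reading 2026-08-22T23:10Z:
*"the printed carrier of (3.3)–(3.38) is the ZERO-FIELD INFINITE-LATTICE scalar propagator G_k(0) = G_k(ηℤ^d,0) with its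
(2.6)-pieces"*); file 2 of p26 g34's pair (`B3Ineq210ZeroLattice` = (2.6)/(2.10), this file = (2.11)).  WHICH §3 INPUT IT SERVES
(owner's request): the Hölder hypothesis of (3.14) p. 436 — *"If φ′ is a leg of a propagator with an index j″, whose second leg is
localized in Δ(v″), then the last supremum in (3.13) can be estimated by O(1)(L^{j″}η)^{−d+1−α} sup exp[−δ₀(L^{j″}η)^{−1}dist(Γ_{x,x′},
Δ(v″))]"* — i.e. the hypothesis `hleg` of `B3Ineq314Local.abs_term312_le_local` / `B3Ineq314Cubes.abs_term312_le_local_cubes`, which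
`B3Ineq314LegZeroTorus.leg_holder_of_ineq211` derives from `Ineq211At` on the zero-field TORUS carrier; the present file supplies the
same `Ineq211At` for the pieces of `G_k(0)` on `ηℤ^{d+1}`, the carrier on which (3.13)/(3.14) are printed.  Lineage used BY NAME:
p03 g4 `B3Ineq211ZeroBox.abs_pieceDD_le` (the box clause, uniform in the box) and `ScaledKernels.Ineq211At.interpolate`, p26 g34
`B3Ineq210ZeroLattice` (pieces, `tendsto_pieceCube`, `ineq210_zeroLattice`), p03 g8 `B3GkZeroLattice` (cubes, `ctr_mem`, `LabRad`).

WHAT IS PRINTED.  p. 426 [PDF 16], verbatim: *"This applies also to Hölder norms, e.g. we have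
(1/|x₂−x₁|^α)|U(B̃(Γ_{x₁,x₂}))(D^η_{B̃,μ}G^η_{(j)})(Ω,B̃;x₂,x) − (D^η_{B̃,μ}G^η_{(j)})(Ω,B̃;x₁,x)| ≤ O(1)(L^jη)^{−d+1−α}e^{−δ₁(L^jη)^{−1}dist({x₁,x₂},x)},
0 ≤ α < 1. (2.11) … These inequalities will be used in the next chapter. They all are obtained by rescaling from the η-lattice to the
L^{−j}-lattice and application of Propositions I.2.1 and I.2.3."*

WHAT IS REPRODUCED, and how (kind «model-instance», G.1 of `HOME/PHASE2-TARGETS.md`).  Counting normalisation as in file 1.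
* §1 **(2.11) FOR THE LATTICE PIECES, piecewise, lattice units** (`abs_pieceLatDD_le`): for every `0 ≤ α < 1`, `∃ δ₁(α), C(α) > 0` with
  `(L^k/|x₂−x₁|_∞)^α·L^k·|(G^η_{(j)}(0)(x₂+e_μ,x) − G^η_{(j)}(0)(x₂,x)) − (G^η_{(j)}(0)(x₁+e_μ,x) − G^η_{(j)}(0)(x₁,x))| ≤
  C·L^{−j(d+1)}·s_j^αs_j^{−1}·e^{−δ₁min(|x₁−x|_∞,|x₂−x|_∞)/L^j}` for ALL `x₁ ≠ x₂`, `x` in `ℤ^{d+1}`, `k ≥ 1`, `j < k`, window — p03 g4's box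
  clause `B3Ineq211ZeroBox.abs_pieceDD_le` (through [B4] (2.36)–(2.39) at `A = 0`), whose constants do not see the box, passed to the
  limit along the centred cubes (`B3Ineq210ZeroLattice.tendsto_pieceCube` at the five points involved);
* §2 the carrier `zeroLatticeKernelsH d ℓ k hℓ a m2` (= `zeroLatticeKernels` + `dist2 = η·min(|x₁−x|_∞,|x₂−x|_∞)` + `holderDiff` = the
  (2.11) numerator with `U ≡ 1`), `ineq210_zeroLatticeH` ((2.10) carried over from file 1), **`ineq211At_zeroLatticeH`**: `∀ 0 ≤ α < 1
  ∃ δ₁ C > 0 ∀ k ≥ 1, window: (zeroLatticeKernelsH …).Ineq211At α δ₁ C`, **`ineq211At_zeroLatticeH_upto`**: one pair `(δ₁, C)` for all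
  `α ∈ [0, α⋆]` (p03's interpolation in the exponent), and `ineq210_and_211At_zeroLatticeH`: (2.10) ∧ (2.11) on the same carrier with
  the same constants (what a (3.13)/(3.14) consumer takes); §3 witness.

HONEST SCOPE / DECLARED DIVERGENCES (F7).  (i) Zero field (`U ≡ 1`: the parallel transport `U(B̃(Γ_{x₁,x₂}))` of (2.11) is `1`),
`Ω = ηℤ^{d+1}`; general `Ω`/regular `B̃` are the lineage's torus/region members (`B3Ineq211ZeroTorus`, `B3Ineq211RegularTorus`,
`B3Ineq211RegularRegion`).  (ii) PER-`α` constants (GAPS G-B3-11 / the decl of record `Ineq211At`; [B4] p. 573 «c₀ [depends] on α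
also»), uniform on compact sub-intervals `[0, α⋆]`.  (iii) Forward differences in the ROW variable, sup-norm distances `× η`,
`dist({x₁,x₂},x) = min` of the two distances; existential constants.  (iv) The pieces are the kernel limits of `B3Ineq210ZeroLattice`
(see its scope notes).  (v) ROUTE = the print's, through p03 g4's kernel-proved box clause + the infinite-volume limit.  Theorems + one
`ScaledKernels` instance; no Literature fact minted, no `sorry`; standard axioms.  Value = the (2.11) input of (3.14) on the printed
carrier, NOT summit progress.
Unit `lit-balaban-p26` (Phase-2 proof seat p26, gen 34); HOME `run/shared/lean/pub/lit-balaban/` (row B3.Eq2.11, FILED.md, STATUS.md),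
2026-08-22.
-/

namespace Literature.MathematicalPhysics.QuantumFieldTheory.Balaban1983to89.B3Ineq211ZeroLattice

open Finset Matrix Filter Topology
open Literature.MathematicalPhysics.QuantumFieldTheory.Balaban1983to89.B4ContourShift (supNorm supNorm_nonneg
  abs_le_supNorm)
open Literature.MathematicalPhysics.QuantumFieldTheory.Balaban1983to89.B4Reflection242
open Literature.MathematicalPhysics.QuantumFieldTheory.Balaban1983to89.B4BoxCov237
open Literature.MathematicalPhysics.QuantumFieldTheory.Balaban1983to89.B4TwoBox120
open Literature.MathematicalPhysics.QuantumFieldTheory.Balaban1983to89.B4Thm110ZeroBox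
open Literature.MathematicalPhysics.QuantumFieldTheory.Balaban1983to89.B3GkZeroLattice
open Literature.MathematicalPhysics.QuantumFieldTheory.Balaban1983to89.B3Ineq210ZeroBox (piece piece_of_le)
open Literature.MathematicalPhysics.QuantumFieldTheory.Balaban1983to89.B3Ineq210ZeroLattice
open Literature.MathematicalPhysics.QuantumFieldTheory.Balaban1983to89.B3Ineq211ZeroBox (abs_pieceDD_le)
open Literature.MathematicalPhysics.QuantumFieldTheory.Balaban1983to89.B3Sect2StatementsPart2 (ScaledKernels)

noncomputable section

variable {d : ℕ}

/-! ## §1 (2.11) for the lattice pieces, piecewise and in lattice units: p03 g4's box clause passed to the limit -/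

/-- kernel: centring commutes with a lattice translation. [folklore] -/
private theorem ctr_add_vec (n t : ℕ) (x v : Fin (d + 1) → ℤ) : ctr n t (x + v) = ctr n t x + v := by
  funext i; simp only [ctr_apply, Pi.add_apply]; ring

/-- kernel: centring is injective. [folklore] -/
private theorem ctr_ne_ctr {n t : ℕ} {x y : Fin (d + 1) → ℤ} (h : x ≠ y) : ctr n t x ≠ ctr n t y := by
  intro hc
  apply h
  have := congrArg (fun z => z - ctr n t y) hc
  simpa only [ctr_sub_ctr, sub_self, sub_eq_zero] using this

/-- **B3 (2.11) p. 426 [PDF 16] FOR THE LATTICE PIECES `G^η_{(j)}(0)` of `G_k(0) = G_k(ηℤ^{d+1}, 0)`, PIECEWISE AND IN LATTICE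
UNITS** (counting normalisation; zero field, `U ≡ 1`, `D^η_{0,μ} = η^{−1}·`forward difference): for every `0 ≤ α < 1` there are
`δ₁ = δ₁(α) > 0`, `C = C(α) > 0` (depending on `d`, `L`, the window and `α`) such that for every `k ≥ 1`, `j < k`, every point of the
window, every axis `μ`, all `x₁ ≠ x₂` and every `x` in `ℤ^{d+1}`:
`(L^k/|x₂−x₁|_∞)^α · L^k·|(G^η_{(j)}(0)(x₂+e_μ,x) − G^η_{(j)}(0)(x₂,x)) − (G^η_{(j)}(0)(x₁+e_μ,x) − G^η_{(j)}(0)(x₁,x))|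
≤ C·L^{−j(d+1)}·(s_j^αs_j^{−1})·e^{−δ₁·min(|x₁−x|_∞,|x₂−x|_∞)/L^j}` (`s_j = L^{k−j} = (L^jη)^{−1}`) — the printed
`O(1)(L^jη)^{−d+1−α}e^{−δ₁(L^jη)^{−1}dist({x₁,x₂},x)}` times `η^{d+1}`: p03 g4's box clause `B3Ineq211ZeroBox.abs_pieceDD_le` (uniform in
the box; route = the print's «rescaling … Propositions I.2.1 and I.2.3» through [B4] (2.36)–(2.39) at `A = 0`) in the limit along
the centred cubes (`B3Ineq210ZeroLattice.tendsto_pieceCube`). [cite: Balaban1983Higgs3, (2.11) p.426] -/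
theorem abs_pieceLatDD_le (d ℓ : ℕ) (hℓ : 1 ≤ ℓ) (amin aplus m2plus : ℝ) (ha : 0 < amin) {α : ℝ} (hα0 : 0 ≤ α)
    (hα1 : α < 1) :
    ∃ δ₁ C : ℝ, 0 < δ₁ ∧ 0 < C ∧ ∀ (k : ℕ), 1 ≤ k → ∀ (j : ℕ), j < k → ∀ (a m2 : ℝ), amin ≤ a → a ≤ aplus →
      0 ≤ m2 → m2 ≤ m2plus → ∀ (μ : Fin (d + 1)) (x₁ x₂ : Fin (d + 1) → ℤ), x₂ ≠ x₁ → ∀ (x : Fin (d + 1) → ℤ),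
        ((((ℓ + 1) ^ k : ℕ) : ℝ) / supNorm (x₂ - x₁)) ^ α *
            ((((ℓ + 1) ^ k : ℕ) : ℝ) * |(pieceLat ℓ k j a m2 (x₂ + Pi.single μ 1) x - pieceLat ℓ k j a m2 x₂ x)
              - (pieceLat ℓ k j a m2 (x₁ + Pi.single μ 1) x - pieceLat ℓ k j a m2 x₁ x)|)
          ≤ C * ((((bj ℓ j : ℕ) : ℝ) ^ (d + 1))⁻¹ * (sc ℓ k j ^ α * (sc ℓ k j)⁻¹))
            * Real.exp (-(δ₁ * min (supNorm (x₁ - x)) (supNorm (x₂ - x)) / ((bj ℓ j : ℕ) : ℝ))) := by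
  obtain ⟨δ₁, C, hδ₁, hC, h⟩ := abs_pieceDD_le d ℓ hℓ amin aplus m2plus ha hα0 hα1
  refine ⟨δ₁, C, hδ₁, hC, ?_⟩
  intro k hk j hjk a m2 h1 h2 h3 h4 μ x₁ x₂ hne x
  obtain ⟨R₁, hx₁, hx₂⟩ := exists_labRad₂ ((ℓ + 1) ^ k) x₁ x₂
  obtain ⟨R₂, hxe₁, hxe₂⟩ := exists_labRad₂ ((ℓ + 1) ^ k) (x₁ + Pi.single μ 1) (x₂ + Pi.single μ 1)
  obtain ⟨R₃, hx, -⟩ := exists_labRad₂ ((ℓ + 1) ^ k) x x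
  have hn : 1 ≤ (ℓ + 1) ^ k := Nat.one_le_pow _ _ (by omega)
  have ha0 : 0 < a := ha.trans_le h1
  have hT := tendsto_pieceCube (d := d) (ℓ := ℓ) (k := k) (a := a) (m2 := m2) hℓ hk ha0 h3 j
  have hconv := ((((hT (x₂ + Pi.single μ 1) x).sub (hT x₂ x)).sub ((hT (x₁ + Pi.single μ 1) x).sub (hT x₁ x))).abs.const_mul
    ((((ℓ + 1) ^ k : ℕ)) : ℝ)).const_mul (((((ℓ + 1) ^ k : ℕ) : ℝ) / supNorm (x₂ - x₁)) ^ α)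
  refine le_of_tendsto hconv (eventually_atTop.2 ⟨R₁ + R₂ + R₃, fun t ht => ?_⟩)
  have hm₁ := ctr_mem (d := d) hn (show R₁ ≤ t by omega) hx₁
  have hm₂ := ctr_mem (d := d) hn (show R₁ ≤ t by omega) hx₂
  have hme₁ := ctr_mem (d := d) hn (show R₂ ≤ t by omega) hxe₁
  have hme₂ := ctr_mem (d := d) hn (show R₂ ≤ t by omega) hxe₂
  have hm := ctr_mem (d := d) hn (show R₃ ≤ t by omega) hx
  have hrel₁ : ctr ((ℓ + 1) ^ k) t (x₁ + Pi.single μ 1) = ctr ((ℓ + 1) ^ k) t x₁ + Pi.single μ 1 := ctr_add_vec _ t x₁ _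
  have hrel₂ : ctr ((ℓ + 1) ^ k) t (x₂ + Pi.single μ 1) = ctr ((ℓ + 1) ^ k) t x₂ + Pi.single μ 1 := ctr_add_vec _ t x₂ _
  have hb := h k hk j hjk a m2 h1 h2 h3 h4 (cubeM t) (cubeM_pos t) μ ⟨_, hm₁⟩ ⟨_, hme₁⟩ ⟨_, hm₂⟩ ⟨_, hme₂⟩ hrel₁ hrel₂
    (ctr_ne_ctr hne) ⟨_, hm⟩
  simp only [ctr_sub_ctr] at hb
  simpa only [pieceCube, dif_pos (And.intro hme₂ hm), dif_pos (And.intro hm₂ hm), dif_pos (And.intro hme₁ hm),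
    dif_pos (And.intro hm₁ hm)] using hb

/-! ## §2 The carrier with the (2.11) fields modelled, `Ineq210` carried over, and (2.11) DISCHARGED per `α` -/

/-- **The concrete carrier of B3 (2.5)/(2.10)–(2.12) FOR `G_k(0)` ON `ηℤ^{d+1}` WITH THE (2.11) FIELDS**: all fields of
`B3Ineq210ZeroLattice.zeroLatticeKernels` (sites `ℤ^{d+1}` in lattice units, `dist = η|·|_∞`, the (2.10) kernels `absG`/`absDG` of
the lattice pieces in the print's `η^d`-normalisation), and IN ADDITION `dist2 x₁ x₂ x = η·min(|x₁−x|_∞, |x₂−x|_∞)`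
(= `dist({x₁,x₂},x)`) and `holderDiff j μ x₁ x₂ x = |U(B̃(Γ_{x₁,x₂}))(D^η_{B̃,μ}G^η_{(j)})(x₂,x) − (D^η_{B̃,μ}G^η_{(j)})(x₁,x)|` at
`B̃ = 0` (`U ≡ 1`) `= η^{−(d+1)}·η^{−1}·|(G^η_{(j)}(0)(x₂+e_μ,x) − G^η_{(j)}(0)(x₂,x)) − (G^η_{(j)}(0)(x₁+e_μ,x) − G^η_{(j)}(0)(x₁,x))|`
(every bond of the lattice).  DECLARED DIVERGENCE (F7): the (2.5) and (2.12) fields (`Bond`, `LocFn`, `distBlock`, `distSupp`,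
`distΩ₂`, `eRun`, `pRun`, `absGavg`, `normDeltaG`, `norm116`) are NOT MODELLED (`Unit`/`0`) — (2.12) concerns the torus vector-field
covariance (`B3Ineq212VectorTorus`), not `G_k(0)`; nothing is claimed about `Ineq25`/`Ineq212` of this instance.
[cite: Balaban1983Higgs3, (2.6) p.424, (2.10)–(2.11) p.426] -/
def zeroLatticeKernelsH (d ℓ k : ℕ) (hℓ : 1 ≤ ℓ) (a m2 : ℝ) : ScaledKernels where
  Site := Fin (d + 1) → ℤ
  Bond := Unit
  Dir := Fin (d + 1)
  LocFn := Unit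
  dist x x' := supNorm (x - x') / (((ℓ + 1) ^ k : ℕ) : ℝ)
  dist2 x₁ x₂ x := min (supNorm (x₁ - x)) (supNorm (x₂ - x)) / (((ℓ + 1) ^ k : ℕ) : ℝ)
  distBlock _ _ _ := 0
  distSupp _ _ := 0
  distΩ₂ := 0
  L := (ℓ : ℝ) + 1
  η := ((((ℓ + 1) ^ k : ℕ) : ℝ))⁻¹
  d := d + 1
  eRun := 0
  pRun := 0
  one_lt_L := one_lt_L_real hℓ
  η_pos := inv_pos.2 (by positivity)
  absG j x x' := ((((ℓ + 1) ^ k : ℕ) : ℝ)) ^ (d + 1) * |pieceLat ℓ k j a m2 x x'|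
  absDG j μ x x' :=
    ((((ℓ + 1) ^ k : ℕ) : ℝ)) ^ (d + 1)
      * (((((ℓ + 1) ^ k : ℕ) : ℝ)) * |pieceLat ℓ k j a m2 (x + Pi.single μ 1) x' - pieceLat ℓ k j a m2 x x'|)
  holderDiff j μ x₁ x₂ x :=
    ((((ℓ + 1) ^ k : ℕ) : ℝ)) ^ (d + 1)
      * (((((ℓ + 1) ^ k : ℕ) : ℝ))
        * |(pieceLat ℓ k j a m2 (x₂ + Pi.single μ 1) x - pieceLat ℓ k j a m2 x₂ x)
            - (pieceLat ℓ k j a m2 (x₁ + Pi.single μ 1) x - pieceLat ℓ k j a m2 x₁ x)|)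
  absGavg _ _ _ := 0
  normDeltaG _ _ _ := 0
  norm116 _ _ _ _ _ := 0

section CarrierH

variable {ℓ k : ℕ} {hℓ : 1 ≤ ℓ} {a m2 : ℝ}

/-- the length scale `L^jη = s_j^{-1}` of the carrier (`j ≤ k`). [cite: Balaban1983Higgs3, (2.11) p.426] -/
theorem scaleH_eq {j : ℕ} (hj : j ≤ k) : (zeroLatticeKernelsH d ℓ k hℓ a m2).scale j = (sc ℓ k j)⁻¹ :=
  scale_eq_inv_sc (d := d) (hℓ := hℓ) (a := a) (m2 := m2) hj

/-- the length scales of the carrier are positive. [cite: Balaban1983Higgs3, (2.11) p.426] -/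
theorem scaleH_pos (j : ℕ) : 0 < (zeroLatticeKernelsH d ℓ k hℓ a m2).scale j :=
  scale_pos' (d := d) (hℓ := hℓ) (a := a) (m2 := m2) j

/-- `(L^jη)^{-1}·dist({x₁,x₂},x) = min(|x₁−x|_∞,|x₂−x|_∞)/L^j` (lattice units). [cite: Balaban1983Higgs3, (2.11) p.426] -/
theorem scaleH_inv_mul_dist2 {j : ℕ} (hj : j ≤ k) (x₁ x₂ x : Fin (d + 1) → ℤ) :
    ((zeroLatticeKernelsH d ℓ k hℓ a m2).scale j)⁻¹ * (zeroLatticeKernelsH d ℓ k hℓ a m2).dist2 x₁ x₂ x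
      = min (supNorm (x₁ - x)) (supNorm (x₂ - x)) / ((bj ℓ j : ℕ) : ℝ) := by
  rw [scaleH_eq hj, inv_inv]
  show sc ℓ k j * (min (supNorm (x₁ - x)) (supNorm (x₂ - x)) / (((ℓ + 1) ^ k : ℕ) : ℝ))
    = min (supNorm (x₁ - x)) (supNorm (x₂ - x)) / ((bj ℓ j : ℕ) : ℝ)
  have h := sc_mul_bj (ℓ := ℓ) hj
  rw [bj_cast] at h
  have hs := (sc_pos ℓ k j).ne'
  have hL : (0 : ℝ) < ((ℓ : ℝ) + 1) ^ j := by positivity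
  push_cast [bj_cast]
  rw [← h]
  field_simp

/-- the Hölder weight `1/dist(x₁,x₂)^α = (L^k/|x₂−x₁|_∞)^α` (lattice units). [cite: Balaban1983Higgs3, (2.11) p.426] -/
theorem distH_rpow_inv (x₁ x₂ : Fin (d + 1) → ℤ) (α : ℝ) :
    ((zeroLatticeKernelsH d ℓ k hℓ a m2).dist x₁ x₂ ^ α)⁻¹
      = ((((ℓ + 1) ^ k : ℕ) : ℝ) / supNorm (x₂ - x₁)) ^ α := by
  show ((supNorm (x₁ - x₂) / (((ℓ + 1) ^ k : ℕ) : ℝ)) ^ α)⁻¹ = _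
  rw [← Real.inv_rpow (div_nonneg (supNorm_nonneg _) (Nat.cast_nonneg _)), inv_div,
    ← B4TorusKernel.supNorm_neg, neg_sub]

/-- the distances of the carrier are non-negative. [cite: Balaban1983Higgs3, (2.11) p.426] -/
theorem distH_nonneg (x₁ x₂ : Fin (d + 1) → ℤ) : 0 ≤ (zeroLatticeKernelsH d ℓ k hℓ a m2).dist x₁ x₂ :=
  div_nonneg (supNorm_nonneg _) (Nat.cast_nonneg _)

/-- the two-point distances of the carrier are non-negative. [cite: Balaban1983Higgs3, (2.11) p.426] -/
theorem dist2H_nonneg (x₁ x₂ x : Fin (d + 1) → ℤ) : 0 ≤ (zeroLatticeKernelsH d ℓ k hℓ a m2).dist2 x₁ x₂ x :=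
  div_nonneg (le_min (supNorm_nonneg _) (supNorm_nonneg _)) (Nat.cast_nonneg _)

/-- kernel: `η^{−n}·L^{−jn} = s_j^n` (`L^k = s_jb_j`). [folklore] -/
private theorem Lk_pow_mul_inv_bj_pow {ℓ k j : ℕ} (hj : j ≤ k) (n : ℕ) :
    ((((ℓ + 1) ^ k : ℕ) : ℝ)) ^ n * ((((bj ℓ j : ℕ) : ℝ)) ^ n)⁻¹ = sc ℓ k j ^ n := by
  have h := sc_mul_bj (ℓ := ℓ) hj
  rw [bj_cast] at h
  have hL : (0 : ℝ) < ((ℓ : ℝ) + 1) ^ j := by positivity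
  push_cast [bj_cast]
  rw [← h, mul_pow]
  field_simp

/-- kernel: `(s⁻¹)^{1−n−α} = s^n·(s^α·s^{−1})` (real exponent). [folklore] -/
private theorem inv_rpow_one_sub_sub {s : ℝ} (hs : 0 < s) (n : ℕ) (α : ℝ) :
    (s⁻¹) ^ ((1 : ℝ) - (n : ℝ) - α) = s ^ n * (s ^ α * s⁻¹) := by
  have hα : 0 < s ^ α := Real.rpow_pos_of_pos hs α
  rw [Real.inv_rpow hs.le, Real.rpow_sub hs, Real.rpow_sub hs, Real.rpow_one, Real.rpow_natCast]
  field_simp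

end CarrierH

/-- **(2.10) for the carrier**: `Ineq210 δ₁ C` of `zeroLatticeKernelsH` IS `Ineq210 δ₁ C` of `B3Ineq210ZeroLattice.zeroLatticeKernels`
(the (2.10) fields coincide), discharged by `B3Ineq210ZeroLattice.ineq210_zeroLattice`. [cite: Balaban1983Higgs3, (2.10) p.426] -/
theorem ineq210_zeroLatticeH (d ℓ : ℕ) (hℓ : 1 ≤ ℓ) (amin aplus m2plus : ℝ) (ha : 0 < amin) :
    ∃ δ₁ C : ℝ, 0 < δ₁ ∧ 0 < C ∧ ∀ (k : ℕ), 1 ≤ k → ∀ (a m2 : ℝ), amin ≤ a → a ≤ aplus → 0 ≤ m2 →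
      m2 ≤ m2plus → (zeroLatticeKernelsH d ℓ k hℓ a m2).Ineq210 δ₁ C := by
  obtain ⟨δ₁, C, hδ, hC, h⟩ := ineq210_zeroLattice d ℓ hℓ amin aplus m2plus ha
  exact ⟨δ₁, C, hδ, hC, fun k hk a m2 h1 h2 h3 h4 => h k hk a m2 h1 h2 h3 h4⟩

/-- **B3 (2.11) p. 426 [PDF 16] — the decl of record `ScaledKernels.Ineq211At α δ₁ C` (r15 gen 5, GAPS G-B3-11) DISCHARGED, FOR EACH
`0 ≤ α < 1`, FOR PRINT'S §3 PROPAGATOR `G_k(0) = G_k(ηℤ^{d+1}, 0)`.**  Verbatim: *"This applies also to Hölder norms, e.g. we have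
(1/|x₂−x₁|^α)|U(B̃(Γ_{x₁,x₂}))(D^η_{B̃,μ}G^η_{(j)})(Ω,B̃;x₂,x) − (D^η_{B̃,μ}G^η_{(j)})(Ω,B̃;x₁,x)| ≤
O(1)(L^jη)^{−d+1−α}e^{−δ₁(L^jη)^{−1}dist({x₁,x₂},x)}, 0 ≤ α < 1. (2.11) … These inequalities will be used in the next chapter."*;
p. 433: *"with the scalar field propagator equal to G_k(0)"*.  HERE: for every `0 ≤ α < 1` there are `δ₁ > 0`, `C > 0` depending only
on `d + 1`, `L = ℓ + 1`, the window `[a₋,a₊] × [0,m²₊]` AND `α` ([B4] p. 573: «c₀ [depends] on α also») such that for EVERY scale `k ≥ 1`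
and every `(a, m²)` in the window the carrier `zeroLatticeKernelsH` of the lattice pieces `G^η_{(j)}(0)` satisfies `Ineq211At α δ₁ C`:
`holderDiff j μ x₁ x₂ x / dist(x₁,x₂)^α ≤ C·(L^jη)^{1−(d+1)−α}·e^{−δ₁(L^jη)^{−1}dist2 x₁ x₂ x}` for all `j`, `μ`, `x₁ ≠ x₂`, `x` in `ℤ^{d+1}`.
HONEST SCOPE: as `B3Ineq210ZeroLattice.ineq210_zeroLattice` — zero field (`U ≡ 1`: the parallel transport in (2.11) is `1`),
`Ω = ηℤ^{d+1}` (the printed §3 case), forward differences in the row variable, sup norm, existential per-`α` constants; the pieces are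
the kernel limits of the box pieces along p03's centred cubes; ROUTE = p03 g4's box clause (`B3Ineq211ZeroBox.abs_pieceDD_le`, the
print's «rescaling … Propositions I.2.1 and I.2.3» = [B4] (2.36)–(2.39) at `A = 0`) in the limit (`abs_pieceLatDD_le`).
[cite: Balaban1983Higgs3, (2.11) p.426] -/
theorem ineq211At_zeroLatticeH (d ℓ : ℕ) (hℓ : 1 ≤ ℓ) (amin aplus m2plus : ℝ) (ha : 0 < amin) {α : ℝ} (hα0 : 0 ≤ α)
    (hα1 : α < 1) :
    ∃ δ₁ C : ℝ, 0 < δ₁ ∧ 0 < C ∧ ∀ (k : ℕ), 1 ≤ k → ∀ (a m2 : ℝ), amin ≤ a → a ≤ aplus → 0 ≤ m2 →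
      m2 ≤ m2plus → (zeroLatticeKernelsH d ℓ k hℓ a m2).Ineq211At α δ₁ C := by
  obtain ⟨δ₁, C, hδ, hC, hDD⟩ := abs_pieceLatDD_le d ℓ hℓ amin aplus m2plus ha hα0 hα1
  refine ⟨δ₁, C, hδ, hC, ?_⟩
  intro k hk a m2 h1 h2 h3 h4 j μ x₁ x₂ x hne
  change (Fin (d + 1) → ℤ) at x₁ x₂ x
  change Fin (d + 1) at μ
  have hne' : x₂ ≠ x₁ := fun h => hne h.symm
  have hsp : 0 < (zeroLatticeKernelsH d ℓ k hℓ a m2).scale j := scaleH_pos j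
  have hSd : ((zeroLatticeKernelsH d ℓ k hℓ a m2).d : ℝ) = ((d + 1 : ℕ) : ℝ) := rfl
  have hRHS : 0 ≤ C * (zeroLatticeKernelsH d ℓ k hℓ a m2).scale j ^ (1 - ((zeroLatticeKernelsH d ℓ k hℓ a m2).d : ℝ) - α)
      * Real.exp (-(δ₁ * ((zeroLatticeKernelsH d ℓ k hℓ a m2).scale j)⁻¹
          * (zeroLatticeKernelsH d ℓ k hℓ a m2).dist2 x₁ x₂ x)) :=
    mul_nonneg (mul_nonneg hC.le (Real.rpow_pos_of_pos hsp _).le) (Real.exp_pos _).le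
  rw [div_eq_mul_inv, distH_rpow_inv]
  show ((((ℓ + 1) ^ k : ℕ) : ℝ)) ^ (d + 1)
        * (((((ℓ + 1) ^ k : ℕ) : ℝ))
          * |(pieceLat ℓ k j a m2 (x₂ + Pi.single μ 1) x - pieceLat ℓ k j a m2 x₂ x)
              - (pieceLat ℓ k j a m2 (x₁ + Pi.single μ 1) x - pieceLat ℓ k j a m2 x₁ x)|)
      * ((((ℓ + 1) ^ k : ℕ) : ℝ) / supNorm (x₂ - x₁)) ^ α ≤ _
  rcases Nat.lt_or_ge j k with hjk | hkj
  · have hj : j ≤ k := hjk.le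
    have hs := sc_pos ℓ k j
    have hd := hDD k hk j hjk a m2 h1 h2 h3 h4 μ x₁ x₂ hne' x
    have hexp : Real.exp (-(δ₁ * ((zeroLatticeKernelsH d ℓ k hℓ a m2).scale j)⁻¹
          * (zeroLatticeKernelsH d ℓ k hℓ a m2).dist2 x₁ x₂ x))
        = Real.exp (-(δ₁ * min (supNorm (x₁ - x)) (supNorm (x₂ - x)) / ((bj ℓ j : ℕ) : ℝ))) := by
      rw [mul_assoc, scaleH_inv_mul_dist2 hj, mul_div_assoc]
    have hpow : (zeroLatticeKernelsH d ℓ k hℓ a m2).scale j ^ (1 - ((zeroLatticeKernelsH d ℓ k hℓ a m2).d : ℝ) - α)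
        = sc ℓ k j ^ (d + 1) * (sc ℓ k j ^ α * (sc ℓ k j)⁻¹) := by
      rw [scaleH_eq hj, hSd, inv_rpow_one_sub_sub hs]
    rw [hexp, hpow]
    calc ((((ℓ + 1) ^ k : ℕ) : ℝ)) ^ (d + 1)
          * (((((ℓ + 1) ^ k : ℕ) : ℝ))
            * |(pieceLat ℓ k j a m2 (x₂ + Pi.single μ 1) x - pieceLat ℓ k j a m2 x₂ x)
                - (pieceLat ℓ k j a m2 (x₁ + Pi.single μ 1) x - pieceLat ℓ k j a m2 x₁ x)|)
          * ((((ℓ + 1) ^ k : ℕ) : ℝ) / supNorm (x₂ - x₁)) ^ α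
        = ((((ℓ + 1) ^ k : ℕ) : ℝ)) ^ (d + 1)
          * (((((ℓ + 1) ^ k : ℕ) : ℝ) / supNorm (x₂ - x₁)) ^ α
            * (((((ℓ + 1) ^ k : ℕ) : ℝ))
              * |(pieceLat ℓ k j a m2 (x₂ + Pi.single μ 1) x - pieceLat ℓ k j a m2 x₂ x)
                  - (pieceLat ℓ k j a m2 (x₁ + Pi.single μ 1) x - pieceLat ℓ k j a m2 x₁ x)|)) := by
          ring
      _ ≤ ((((ℓ + 1) ^ k : ℕ) : ℝ)) ^ (d + 1) * (C * ((((bj ℓ j : ℕ) : ℝ) ^ (d + 1))⁻¹ * (sc ℓ k j ^ α * (sc ℓ k j)⁻¹))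
            * Real.exp (-(δ₁ * min (supNorm (x₁ - x)) (supNorm (x₂ - x)) / ((bj ℓ j : ℕ) : ℝ)))) :=
          mul_le_mul_of_nonneg_left hd (by positivity)
      _ = C * (((((ℓ + 1) ^ k : ℕ) : ℝ)) ^ (d + 1) * ((((bj ℓ j : ℕ) : ℝ) ^ (d + 1))⁻¹)
            * (sc ℓ k j ^ α * (sc ℓ k j)⁻¹))
            * Real.exp (-(δ₁ * min (supNorm (x₁ - x)) (supNorm (x₂ - x)) / ((bj ℓ j : ℕ) : ℝ))) := by
          ring
      _ = _ := by rw [Lk_pow_mul_inv_bj_pow hj (d + 1)]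
  · -- no pieces for `j ≥ k`
    have hj1 : 1 ≤ j := le_trans hk hkj
    have hp : ∀ y y' : Fin (d + 1) → ℤ, pieceLat ℓ k j a m2 y y' = 0 := fun y y' => pieceLat_of_le hj1 hkj
    simp only [hp, sub_self, abs_zero, mul_zero, zero_mul]
    exact hRHS

/-- **Row B3.Eq2.11, decl of record, UNIFORMLY on `[0, α⋆]`** (p03 g4's interpolation in the exponent,
`ScaledKernels.Ineq211At.interpolate`, on this carrier — `dist, dist2 ≥ 0`): for every `0 ≤ α⋆ < 1` ONE pair `(δ₁, C)` with
`(zeroLatticeKernelsH d ℓ k hℓ a m2).Ineq211At α δ₁ C` for ALL `α ∈ [0, α⋆]`, every `k ≥ 1` and window point (the print uses (2.11) at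
the fixed `α₀ < 1` of the norms (1.32), p. 433). [cite: Balaban1983Higgs3, (2.11) p.426] -/
theorem ineq211At_zeroLatticeH_upto (d ℓ : ℕ) (hℓ : 1 ≤ ℓ) (amin aplus m2plus : ℝ) (ha : 0 < amin) {αs : ℝ}
    (hαs0 : 0 ≤ αs) (hαs1 : αs < 1) :
    ∃ δ₁ C : ℝ, 0 < δ₁ ∧ 0 < C ∧ ∀ (k : ℕ), 1 ≤ k → ∀ (a m2 : ℝ), amin ≤ a → a ≤ aplus → 0 ≤ m2 →
      m2 ≤ m2plus → ∀ (α : ℝ), 0 ≤ α → α ≤ αs → (zeroLatticeKernelsH d ℓ k hℓ a m2).Ineq211At α δ₁ C := by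
  obtain ⟨δa, Ca, hδa, hCa, h0⟩ := ineq211At_zeroLatticeH d ℓ hℓ amin aplus m2plus ha le_rfl zero_lt_one
  obtain ⟨δb, Cb, hδb, hCb, hs⟩ := ineq211At_zeroLatticeH d ℓ hℓ amin aplus m2plus ha hαs0 hαs1
  refine ⟨min δa δb, max Ca Cb, lt_min hδa hδb, lt_max_of_lt_left hCa, ?_⟩
  intro k hk a m2 h1 h2 h3 h4 α hα0 hαle
  exact ScaledKernels.Ineq211At.interpolate (distH_nonneg (hℓ := hℓ) (a := a) (m2 := m2))
    (dist2H_nonneg (hℓ := hℓ) (a := a) (m2 := m2)) hCa.le hCb.le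
    (h0 k hk a m2 h1 h2 h3 h4) (hs k hk a m2 h1 h2 h3 h4) hα0 hαle

/-- (2.10) and (2.11) on the SAME carrier with ONE pair of constants (per `α`): the conjunction a consumer of both bounds for the
lattice pieces wants. [cite: Balaban1983Higgs3, (2.10)–(2.11) p.426] -/
theorem ineq210_and_211At_zeroLatticeH (d ℓ : ℕ) (hℓ : 1 ≤ ℓ) (amin aplus m2plus : ℝ) (ha : 0 < amin) {α : ℝ}
    (hα0 : 0 ≤ α) (hα1 : α < 1) :
    ∃ δ₁ C : ℝ, 0 < δ₁ ∧ 0 < C ∧ ∀ (k : ℕ), 1 ≤ k → ∀ (a m2 : ℝ), amin ≤ a → a ≤ aplus → 0 ≤ m2 →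
      m2 ≤ m2plus → (zeroLatticeKernelsH d ℓ k hℓ a m2).Ineq210 δ₁ C ∧ (zeroLatticeKernelsH d ℓ k hℓ a m2).Ineq211At α δ₁ C := by
  obtain ⟨δa, Ca, hδa, hCa, hA⟩ := ineq210_zeroLatticeH d ℓ hℓ amin aplus m2plus ha
  obtain ⟨δb, Cb, hδb, hCb, hB⟩ := ineq211At_zeroLatticeH d ℓ hℓ amin aplus m2plus ha hα0 hα1
  refine ⟨min δa δb, max Ca Cb, lt_min hδa hδb, lt_max_of_lt_left hCa, ?_⟩
  intro k hk a m2 h1 h2 h3 h4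
  have hM : 0 ≤ max Ca Cb := le_max_of_le_left hCa.le
  have hd0 : ∀ x x' : Fin (d + 1) → ℤ, 0 ≤ (zeroLatticeKernelsH d ℓ k hℓ a m2).dist x x' :=
    distH_nonneg (hℓ := hℓ) (a := a) (m2 := m2)
  have hd2 : ∀ x₁ x₂ x : Fin (d + 1) → ℤ, 0 ≤ (zeroLatticeKernelsH d ℓ k hℓ a m2).dist2 x₁ x₂ x :=
    dist2H_nonneg (hℓ := hℓ) (a := a) (m2 := m2)
  have hsc : ∀ j, 0 < (zeroLatticeKernelsH d ℓ k hℓ a m2).scale j := scaleH_pos (hℓ := hℓ) (a := a) (m2 := m2)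
  -- weakening a clause `C′·P·e^{−δ′ s q}` (`P, s, q ≥ 0`) to the common constants `(max C, min δ)`
  have wk : ∀ {T C' δ' P s q : ℝ}, 0 ≤ P → 0 ≤ s → 0 ≤ q → C' ≤ max Ca Cb → min δa δb ≤ δ' →
      T ≤ C' * P * Real.exp (-(δ' * s * q)) → T ≤ max Ca Cb * P * Real.exp (-(min δa δb * s * q)) := by
    intro T C' δ' P s q hP hs hq hC' hδ' hT
    have h1 : min δa δb * (s * q) ≤ δ' * (s * q) := mul_le_mul_of_nonneg_right hδ' (mul_nonneg hs hq)
    have h2 : Real.exp (-(δ' * s * q)) ≤ Real.exp (-(min δa δb * s * q)) :=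
      Real.exp_le_exp.2 (by rw [mul_assoc, mul_assoc]; linarith)
    exact hT.trans (mul_le_mul (mul_le_mul_of_nonneg_right hC' hP) h2 (Real.exp_pos _).le (mul_nonneg hM hP))
  refine ⟨fun j x x' => ⟨?_, fun μ => ?_⟩, fun j μ x₁ x₂ x hne => ?_⟩
  · exact wk (Real.rpow_pos_of_pos (hsc j) _).le (inv_pos.2 (hsc j)).le (hd0 x x') (le_max_left _ _)
      (min_le_left _ _) ((hA k hk a m2 h1 h2 h3 h4 j x x').1)
  · exact wk (Real.rpow_pos_of_pos (hsc j) _).le (inv_pos.2 (hsc j)).le (hd0 x x') (le_max_left _ _)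
      (min_le_left _ _) ((hA k hk a m2 h1 h2 h3 h4 j x x').2 μ)
  · exact wk (Real.rpow_pos_of_pos (hsc j) _).le (inv_pos.2 (hsc j)).le (hd2 x₁ x₂ x) (le_max_right _ _)
      (min_le_right _ _) (hB k hk a m2 h1 h2 h3 h4 j μ x₁ x₂ x hne)

/-! ## §3 Non-vacuity: the binders are inhabited (`d + 1 = 3`, `L = 2`, window `[1/2, 2] × [0, 1]`, `α = 1/2`, `k = 1`, `a = 1`,
`m² = 0`) -/

/-- **Non-vacuity witness for the decl of record**: `Ineq211At (1/2) δ₁ C` holds for the instance `d + 1 = 3`, `L = 2`, `k = 1`,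
`a = 1`, `m² = 0` on `ηℤ³` with the constants of `ineq211At_zeroLatticeH` (window `[1/2, 2] × [0, 1]`). [cite: Balaban1983Higgs3, (2.11) p.426] -/
theorem ineq211At_zeroLatticeH_witness :
    ∃ δ₁ C : ℝ, 0 < δ₁ ∧ 0 < C ∧ (zeroLatticeKernelsH 2 1 1 le_rfl 1 0).Ineq211At ((1 : ℝ) / 2) δ₁ C := by
  obtain ⟨δ₁, C, hδ, hC, h⟩ := ineq211At_zeroLatticeH 2 1 le_rfl (1 / 2) 2 1 (by norm_num) (α := (1 : ℝ) / 2)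
    (by norm_num) (by norm_num)
  exact ⟨δ₁, C, hδ, hC, h 1 le_rfl 1 0 (by norm_num) (by norm_num) le_rfl (by norm_num)⟩

end

end Literature.MathematicalPhysics.QuantumFieldTheory.Balaban1983to89.B3Ineq211ZeroLattice
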